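import Mathlib
import HarnessLib
import Summits.ResolutionOfSingularities.ResolutionOfSingularities.Theorems.WildQuotientsWildQuotientResolutionS1aGraphTailBricks

/-!
# S1a — R4c cusp assembly, CROSS-POINT UNITS: a pinned section off the support makes its numerator invertible downstairs

[OURS · L1 W4.5c · crux stmt-ResolutionOfSingularities-17941 `CyclicQuotientFourfolds`, line `s1a-logminvertex` v13 (`stub_reachLowerInFX`); R4c cusp,
UNITS clauses of the glue-and-kill step for pieces of a chart of the OTHER point (leafhand-res-wildquotients-7 g1 memo R4c-PROGRESS-v3 (3) "cross-point
exceptional units"; consumer ✓`GameFrame.GModel.killsIn_one_of_threeCharts_global`, p823439)] — NOT statements of the manuscript; counted 0; AI-level work,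
weaker than expert review.

On the principal chart `X′[U, y]` of a blow-up `π` of `I`, a section `z ∈ Γ(W)` (`W ≤ X′[U, y]`) PINNED by `z · π^*y = π^*t` (the residual sections
`u₀′^{n₀}/c`, `t̂ⁿ/c` of a producer chart are pinned to `t = x₀^{n₀}`, `t = fⁿ`: ✓`QhAbs.qha_residualSection_zero_pin` / `_tail_pin` +
✓`symm_mul_appLE_eq_of_pin`) has, at every point `v ∈ W ∩ D(z)` lying over the complement of `supp I` — e.g. every point of a chart of the other point
centre, the supports being disjoint — an invertible numerator: `π v ∈ D(t)` (✓`mem_basicOpen_appLE_of_mem_blowupChart_of_not_mem_support`: `π^*y` is a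
unit there, and `D(z) ∩ D(π^*y) = D(π^*t)`). With `t = xⁿ` this is `v ∈ D(π^*x|⊤)`, the `D(γ₀)` / `D(γ₁)` clause of the three-chart kill lemma, where the
member generators are invertible by their relations (✓`Scheme.mem_basicOpen_of_mul_eq_map`).
* ★ `base_mem_basicOpen_of_pin_of_not_mem_support`, `mem_basicOpen_appLE_top_of_pin_pow_of_not_mem_support`.
-/

set_option linter.dupNamespace false

noncomputable section

universe u

open CategoryTheory Limits AlgebraicGeometry TopologicalSpace Topology Opposite
open Literature.AlgebraicGeometry.Resolution

namespace Summit.ResolutionOfSingularities.ResolutionOfSingularities.Theorems.WildQuotientResolution.S1.BlowupCharts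

/-- ★ **A pinned section off the support has an invertible numerator.** `π : X′ → X` a blow-up chart situation for the ideal sheaf `I`, `U` affine,
`y, t ∈ Γ(X, U)`, `W ≤ X′[U, y]` with `W ≤ π⁻¹U`, `z ∈ Γ(X′, W)` with `z · π^*y = π^*t`. If `v ∈ W ∩ D(z)` and `π v ∉ supp I`, then `π v ∈ D(t)`.
[OURS · L1 W4.5c · R4c cross-point units; folklore] -/
theorem base_mem_basicOpen_of_pin_of_not_mem_support {X' X : Scheme.{u}} (π : X' ⟶ X) (I : X.IdealSheafData) (U : X.affineOpens)
    (y t : Γ(X, U)) {W : X'.Opens} (hWc : W ≤ blowupChart π I U y) (hW : W ≤ π ⁻¹ᵁ (U : X.Opens))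
    (z : Γ(X', W)) (hz : z * π.appLE U W hW y = π.appLE U W hW t)
    {v : X'} (hvW : v ∈ W) (hvs : π.base v ∉ (I.support : Set X)) (hvz : v ∈ X'.basicOpen z) :
    π.base v ∈ X.basicOpen t := by
  have hy : v ∈ X'.basicOpen (π.appLE U W hW y) :=
    mem_basicOpen_appLE_of_mem_blowupChart_of_not_mem_support π I U y (hWc hvW) hvs hW hvW
  have h : v ∈ X'.basicOpen (π.appLE U W hW t) := by
    rw [← hz, Scheme.basicOpen_mul]; exact ⟨hvz, hy⟩
  rw [Scheme.basicOpen_appLE] at h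
  exact h.2

/-- ★ **Power numerators, global form.** As `base_mem_basicOpen_of_pin_of_not_mem_support` with `t = xⁿ|U` (`0 < n`) for a GLOBAL section `x` of
`X`: then `v ∈ D(π^*x|⊤)` — literally the `D(γ₀)` (`x = x₀`, `z = u₀′^{n₀}/c`) resp. `D(γ₁)` (`x = f`, `z = t̂ⁿ/c`) clause of
✓`killsIn_one_of_threeCharts_global`. [OURS · L1 W4.5c · R4c cross-point units] -/
theorem mem_basicOpen_appLE_top_of_pin_pow_of_not_mem_support {X' X : Scheme.{u}} (π : X' ⟶ X) (I : X.IdealSheafData) (U : X.affineOpens)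
    (y : Γ(X, U)) {O : X.Opens} (hUO : (U : X.Opens) ≤ O) (x : Γ(X, O)) {n : ℕ} (hn : 0 < n)
    {W : X'.Opens} (hWc : W ≤ blowupChart π I U y) (hW : W ≤ π ⁻¹ᵁ (U : X.Opens))
    (z : Γ(X', W)) (hz : z * π.appLE U W hW y = π.appLE U W hW ((X.presheaf.map (homOfLE hUO).op).hom x ^ n))
    {v : X'} (hvW : v ∈ W) (hvs : π.base v ∉ (I.support : Set X)) (hvz : v ∈ X'.basicOpen z)
    (htop : (⊤ : X'.Opens) ≤ π ⁻¹ᵁ O) : v ∈ X'.basicOpen (π.appLE O ⊤ htop x) := by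
  have h := base_mem_basicOpen_of_pin_of_not_mem_support π I U y _ hWc hW z hz hvW hvs hvz
  rw [Scheme.basicOpen_pow _ _ hn] at h
  erw [Scheme.basicOpen_res] at h
  rw [Scheme.basicOpen_appLE]
  exact ⟨Set.mem_univ _, h.2⟩

end Summit.ResolutionOfSingularities.ResolutionOfSingularities.Theorems.WildQuotientResolution.S1.BlowupCharts

end
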